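import Literature.MathematicalPhysics.QuantumFieldTheory.ConformalBootstrap3D.PointKernelK34L505Data
import Literature.MathematicalPhysics.QuantumFieldTheory.ConformalBootstrap3D.PointKernelK34L505Segs
import Literature.MathematicalPhysics.QuantumFieldTheory.ConformalBootstrap3D.PointKernelParts

/-!
# K34L505 certificate, kernel part file P37: one-cell head segments 102, 103 in level ranges

The head cells whose kernel evaluation exceeds one `decide` are one-cell segments of `hsegsK34L505`; each is
checked by `PCert.hPartSideOK` (side conditions) and `PCert.hPartOK` per level range `[n_lo, n_lo + count)`
against an integer claim, the claims summing to `≥ 0` (`PointKernel.partsOK`); soundness is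
`PCert.hParts_sound` (`PointKernelParts`).  The part files are mutually independent (each imports only
the data file); the ranges of one cell may span several of them, and the per-cell conclusions
`hparts_i` / `hcell_i` of those cells are assembled in `PointKernelK34L505.lean`.
Estimated kernel time 250 s.
-/

set_option maxRecDepth 100000
set_option maxHeartbeats 0

namespace Literature.MathematicalPhysics.QuantumFieldTheory.ConformalBootstrap3D.PointKernelK34L505

open Literature.MathematicalPhysics.QuantumFieldTheory.ConformalBootstrap3D.PointKernel

/-- levels `[49, 56)` of segment 102: partial lower sum `≥` claim. [folklore] -/
theorem part_102_3 : certK34L505.hPartOK (PCert.segAt hsegsK34L505 102) JHK34L505 49 7 (1347351650168312930080908396570766142) = true := by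
  decide +kernel

/-- levels `[56, 61)` of segment 102: partial lower sum `≥` claim. [folklore] -/
theorem part_102_4 : certK34L505.hPartOK (PCert.segAt hsegsK34L505 102) JHK34L505 56 5 (466519486699637247474777906313077810) = true := by
  decide +kernel

/-- levels `[61, 65)` of segment 102: partial lower sum `≥` claim. [folklore] -/
theorem part_102_5 : certK34L505.hPartOK (PCert.segAt hsegsK34L505 102) JHK34L505 61 4 (206343858652642279848508839871472859) = true := by
  decide +kernel

/-- one-cell segment 103 (row 6, cell `[7171/1024, 1793/256]`, chord, `n_F = 72`,
10 level ranges): side conditions. [folklore] -/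
theorem pside_103 : certK34L505.hPartSideOK (PCert.segAt hsegsK34L505 103) JHK34L505 = true := by
  decide +kernel

/-- its level ranges `(n_lo, count, claim)`. [folklore] -/
def partsK34L505_103 : List (ℕ × ℕ × ℤ) := [(0, 25, -28199125884065734479696767156862206788), (25, 11, 18139385074507017071735654816511702682), (36, 8, 5887868355383033208771996073456846551), (44, 6, 2107241707359497175534865792446325103), (50, 5, 957756164663482720376090818573079451), (55, 5, 549061156757140523892019167331161388), (60, 4, 263689655796957168172387082105643333), (64, 4, 167885420102566354839083668316652068), (68, 3, 84261405962168411391393275219283668), (71, 2, 41976943533871844983276462901512552)]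

/-- the ranges tile `[0, n_F]` and the claims sum to `≥ 0`. [folklore] -/
theorem pcov_103 : PointKernel.partsOK 72 partsK34L505_103 = true := by
  decide +kernel

/-- levels `[0, 25)` of segment 103: partial lower sum `≥` claim. [folklore] -/
theorem part_103_0 : certK34L505.hPartOK (PCert.segAt hsegsK34L505 103) JHK34L505 0 25 (-28199125884065734479696767156862206788) = true := by
  decide +kernel

end Literature.MathematicalPhysics.QuantumFieldTheory.ConformalBootstrap3D.PointKernelK34L505
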